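import Summits.AtomisticToContinuum.Crystallization.Theorems.OverbindingBudgetAffineCompressedCutLens

/-!
# Overbinding budget, R4 «LR(r₁)» part XII-A — READING TOOLS: copy tables, cap uniqueness, the closed reading budgets, label arithmetic

Route `OverbindingBudget`, crux `RobustDefectLimitWindows`, open leaf `NearFieldSlackMinSecond 12 (1/25)` ⟸ 79K ⟸ LR(r₁).  Tools for the READING of an
arbitrary site of the exclusivity ball `(106/25)·ν` against the stacking datum («Glue».`stack_levels_record`) through the lens («Lens»):

* §1 decide-tables on the four copies `F⁺, F⁻, H, H′`: `copy_shells` (pattern vectors have `tsq ∈ {18, 36}`; first-shell ones are in-layer or caps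
  `thsum = ±6`), `cap_unique` (a copy containing the three caps `capv s ε δ`, `δ ∈ dL`, has NO other first-shell vector of height `6s`).
* §2 the CLOSED reading budgets (every number a lemma, none a hypothesis — rows 1443 (C) / 1456 (D)): `first_shell_budget` (a second-shell child is
  too far: `1.2506 < 1.2755`), `height_budget` (lens point to read label: `2·0.5651² ≤ 0.9975²`, feeds `slab_int`), `label_sep_budget`
  (`3·(2Δ)² < 2β²`, `1.827 < 1.990`: injectivity site ↦ label, and `i ↦ 0`), `reach_lens` (derived from `reach_budget` and `√2/2 < ρ₀`), `shell_far`.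
* §3 label arithmetic: `label_sep` (distinct stacking labels have `tsq ≥ 12`, i.e. model distance `≥ √(2/3)`), `small_label` (a stacking label of
  `tsq ≤ 2` is `0`, at level `0`).
* §4 reading steps: `frame_point` (the frame is onto; the model point of a site of the ball), `level_box` (`placement` + `cover_B`), `read_level` (the
  level of any label read at a site is the lens level `ℓ` or `ℓ + 1`: `height_budget` + `slab_int`), `not_second_shell`.
-/

namespace Summit.AtomisticToContinuum.Crystallization.Theorems.OverbindingBudgetAffineCompressedCutReadingA

open Literature.Geometry.DiscreteGeometry (nearestDist nearestDist_nonneg)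
open Summit.AtomisticToContinuum.Crystallization.Theorems.OverbindingBudgetAffineCompressedCutKernel (T3 tsub tadd tsq thsum fccL fccNegL hcpL hcpAltL)
open Summit.AtomisticToContinuum.Crystallization.Theorems.OverbindingBudgetAffineCompressedCutCharts (mv)
open Summit.AtomisticToContinuum.Crystallization.Theorems.OverbindingBudgetAffineCompressedCutSeed (InLayer)
open Summit.AtomisticToContinuum.Crystallization.Theorems.OverbindingBudgetAffineCompressedCutPatch (capv dL)
open Summit.AtomisticToContinuum.Crystallization.Theorems.OverbindingBudgetAffineCompressedCutBudget (tauR dR reach_budget cover_B)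
open Summit.AtomisticToContinuum.Crystallization.Theorems.OverbindingBudgetAffineCompressedCutLens (rho0 sqrt_two_div_two_lt_rho0 placement
  norm_sub_mv_sq slab_int)

variable {N : ℕ}

/-! ## §1  Tables -/

/-- COPY SHELLS: every vector of a copy has `tsq = 18` (first shell) or `tsq = 36` (second shell); a first-shell vector is an in-layer vector or a
cap of height `±6`. [this file] -/
theorem copy_shells : ∀ C ∈ [fccL, fccNegL, hcpL, hcpAltL], ∀ V ∈ C, (tsq V = 18 ∨ tsq V = 36) ∧
    (tsq V = 18 → (V.1 + V.2.1 + V.2.2 = 0 ∧ (3 : ℤ) ∣ V.1 ∧ (3 : ℤ) ∣ V.2.1) ∨ thsum V = 6 ∨ thsum V = -6) := by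
  decide

/-- ★ CAP UNIQUENESS: if a copy contains the three caps `capv s ε δ` (`δ ∈ dL`), then EVERY first-shell vector of height `6s` in it is one of them. [this file] -/
theorem cap_unique : ∀ C ∈ [fccL, fccNegL, hcpL, hcpAltL], ∀ s ∈ [(1 : ℤ), -1], ∀ ε ∈ [(1 : ℤ), -1],
    (∀ δ ∈ dL, capv s ε δ ∈ C) → ∀ V ∈ C, tsq V = 18 → thsum V = 6 * s → ∃ δ ∈ dL, V = capv s ε δ := by
  decide

/-! ## §2  The closed reading budgets -/

/-- `1.4142 < √2 < 1.4143`. [this file] (lane edit hand-2 g39: ONE `private` token — `dedup.landed` vs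
`Summit.AtomisticToContinuum.Crystallization.Theorems.ChartedZeroExcessLayeredLatticeLiouville.sqrt_two_window`; body verbatim, used only in this file.) -/
private theorem sqrt_two_bounds : (14142 / 10000 : ℝ) < Real.sqrt 2 ∧ Real.sqrt 2 < 14143 / 10000 := by
  constructor
  · rw [Real.lt_sqrt (by norm_num)]; norm_num
  · rw [Real.sqrt_lt' (by norm_num)]; norm_num

/-- ★ **FIRST-SHELL BUDGET** (closed): a site of the lens read through a second-shell pattern vector (`‖v‖ = √2`) of a level site would be too far —
`(401/400)ν·(9/10 − ρ₀ + √2/2) + D₃₁ < (√2 − 11/10⁴)·0.9026ν` (`1.2506ν < 1.2755ν`). [this file] -/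
theorem first_shell_budget {ν : ℝ} (hν : 0 < ν) :
    401 / 400 * ν * (9 / 10 - rho0 + Real.sqrt 2 / 2) + dR ν 31 < (Real.sqrt 2 - 11 / 10000) * (9026 / 10000 * ν) := by
  obtain ⟨h1, h2⟩ := sqrt_two_bounds
  simp only [rho0, dR]
  push_cast
  nlinarith [mul_lt_mul_of_pos_right h1 hν, mul_lt_mul_of_pos_right h2 hν]

/-- ★ **HEIGHT BUDGET** (closed): lens point to read label, `2·((9/10 − ρ₀)β + Δ)² ≤ β²` with `Δ = D₃₁ + 10⁻⁴·1.0347ν + τ₃₁`, `β = (399/400)ν`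
(`0.6387 ≤ 0.9950`) — the read label is within `√(1/2)` of the lens point, so `slab_int` fixes its level to `ℓ` or `ℓ + 1`. [this file] -/
theorem height_budget (ν : ℝ) :
    2 * ((9 / 10 - rho0) * (399 / 400 * ν) + (dR ν 31 + 1 / 10 ^ 4 * (10347 / 10000 * ν) + tauR ν 31)) ^ 2 ≤ (399 / 400 * ν) ^ 2 := by
  simp only [rho0, dR, tauR]
  push_cast
  nlinarith [sq_nonneg ν]

/-- ★ **LABEL-SEPARATION BUDGET** (closed): `3·(2Δ)² < 2β²` (`1.827 < 1.990`), i.e. `2Δ < β·√(2/3)`: two labels `√(2/3)` apart in model units cannot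
both describe one site; also `18Δ² < 3β²`, so the label read at `i` itself has `tsq ≤ 2`. [this file] -/
theorem label_sep_budget {ν : ℝ} (hν : 0 < ν) :
    3 * (2 * (dR ν 31 + 1 / 10 ^ 4 * (10347 / 10000 * ν) + tauR ν 31)) ^ 2 < 2 * (399 / 400 * ν) ^ 2 := by
  simp only [dR, tauR]
  push_cast
  nlinarith [mul_pos hν hν]

/-- REACH THROUGH THE LENS (derived from `reach_budget` and `√2/2 < ρ₀`): `(401/400)ν·(9/10 − ρ₀ + √2/2) + D₃₁ < (3/2 + 1/450)·0.9026ν`. [this file] -/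
theorem reach_lens {ν : ℝ} (hν : 0 < ν) :
    401 / 400 * ν * (9 / 10 - rho0 + Real.sqrt 2 / 2) + dR ν 31 < (3 / 2 + 1 / 450) * (9026 / 10000 * ν) := by
  have h := reach_budget hν
  have hρ := sqrt_two_div_two_lt_rho0
  nlinarith [mul_lt_mul_of_pos_left hρ hν]

/-- SHELL DISTANCE: a site `y m` registered to the pattern vector `v` of `k` (`‖A_k v − Q_k v‖ ≤ 10⁻³`, position error `10⁻⁴ν_k`) lies at distance
`≥ (‖v‖ − 11/10⁴)·ν_k` from `y k`. [this file] -/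
theorem shell_far {y : Fin N → EuclideanSpace ℝ (Fin 3)} {k m : Fin N} {Ak : EuclideanSpace ℝ (Fin 3) →ₗ[ℝ] EuclideanSpace ℝ (Fin 3)}
    {Qk : EuclideanSpace ℝ (Fin 3) →ₗᵢ[ℝ] EuclideanSpace ℝ (Fin 3)} {v : EuclideanSpace ℝ (Fin 3)} (hAv : ‖Ak v - Qk v‖ ≤ 1 / 1000)
    (hpos : dist (y m) (y k + nearestDist y k • Ak v) ≤ 1 / 10 ^ 4 * nearestDist y k) :
    (‖v‖ - 11 / 10000) * nearestDist y k ≤ dist (y m) (y k) := by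
  have hn : 0 ≤ nearestDist y k := nearestDist_nonneg y k
  have h1 : ‖v‖ - 1 / 1000 ≤ ‖Ak v‖ := by
    have h := norm_sub_norm_le (Qk v) (Ak v)
    rw [Qk.norm_map, norm_sub_rev] at h
    linarith
  have h2 : ‖nearestDist y k • Ak v‖ = nearestDist y k * ‖Ak v‖ := by rw [norm_smul, Real.norm_of_nonneg hn]
  have h3 : ‖nearestDist y k • Ak v‖ ≤ ‖y m - y k‖ + ‖y m - y k - nearestDist y k • Ak v‖ := by
    have e : nearestDist y k • Ak v = (y m - y k) - (y m - y k - nearestDist y k • Ak v) := by abel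
    rw [e]
    exact (norm_sub_le _ _).trans (by rw [← e])
  rw [dist_eq_norm, sub_add_eq_sub_sub] at hpos
  rw [dist_eq_norm]
  nlinarith [mul_le_mul_of_nonneg_left h1 hn]

/-! ## §3  Label arithmetic -/
set_option maxHeartbeats 400000 in
/-- ★ **LABEL SEPARATION.**  Two distinct stacking labels `R + x`, `R' + x'` (`thsum R = 6ℓ`, `thsum R' = 6ℓ'`, equal levels have equal origins,
`x, x'` layer vectors) have `tsq ≥ 12` (model distance `≥ √(2/3)`): different levels differ in height by `≥ 6` (Cauchy–Schwarz), the same level by a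
non-zero layer vector (`tsq ≥ 18`). [this file] -/
theorem label_sep {R R' x x' : T3} {ℓ ℓ' : ℤ} (hR : thsum R = 6 * ℓ) (hR' : thsum R' = 6 * ℓ') (hRe : ℓ = ℓ' → R = R') (hx : InLayer x)
    (hx' : InLayer x') (hne : tadd R x ≠ tadd R' x') : 12 ≤ tsq (tsub (tadd R x) (tadd R' x')) := by
  obtain ⟨hs, ⟨a, ha⟩, ⟨b, hb⟩⟩ := hx
  obtain ⟨hs', ⟨a', ha'⟩, ⟨b', hb'⟩⟩ := hx'
  simp only [thsum] at hR hR'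
  by_cases hℓ : ℓ = ℓ'
  · have hRR := hRe hℓ
    subst hRR
    have hd : tsub (tadd R x) (tadd R x') = (3 * (a - a'), 3 * (b - b'), -3 * (a - a') - 3 * (b - b')) := by
      simp only [tsub, tadd, Prod.mk.injEq]
      refine ⟨by linarith, by linarith, by linarith⟩
    have hne' : a - a' ≠ 0 ∨ b - b' ≠ 0 := by
      by_contra h
      push Not at h
      apply hne
      simp only [tadd, Prod.mk.injEq]
      refine ⟨by linarith, by linarith, by linarith⟩
    rw [hd]
    simp only [tsq]
    rcases hne' with h | h
    · have h1 : 1 ≤ (a - a') ^ 2 := by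
        have := Int.one_le_abs h
        nlinarith [sq_abs (a - a'), abs_nonneg (a - a')]
      nlinarith [sq_nonneg (b - b'), sq_nonneg (a - a' + (b - b'))]
    · have h1 : 1 ≤ (b - b') ^ 2 := by
        have := Int.one_le_abs h
        nlinarith [sq_abs (b - b'), abs_nonneg (b - b')]
      nlinarith [sq_nonneg (a - a'), sq_nonneg (a - a' + (b - b'))]
  · have h6 : 6 ≤ |(R.1 + x.1 - (R'.1 + x'.1)) + (R.2.1 + x.2.1 - (R'.2.1 + x'.2.1)) + (R.2.2 + x.2.2 - (R'.2.2 + x'.2.2))| := by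
      have e : (R.1 + x.1 - (R'.1 + x'.1)) + (R.2.1 + x.2.1 - (R'.2.1 + x'.2.1)) + (R.2.2 + x.2.2 - (R'.2.2 + x'.2.2)) = 6 * (ℓ - ℓ') := by
        linarith
      rw [e, abs_mul, abs_of_pos (by norm_num : (0 : ℤ) < 6)]
      have : 1 ≤ |ℓ - ℓ'| := Int.one_le_abs (sub_ne_zero.mpr hℓ)
      linarith
    simp only [tsq, tsub, tadd]
    have hsq := sq_abs ((R.1 + x.1 - (R'.1 + x'.1)) + (R.2.1 + x.2.1 - (R'.2.1 + x'.2.1)) + (R.2.2 + x.2.2 - (R'.2.2 + x'.2.2)))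
    nlinarith [sq_nonneg (R.1 + x.1 - (R'.1 + x'.1) - (R.2.1 + x.2.1 - (R'.2.1 + x'.2.1))),
      sq_nonneg (R.2.1 + x.2.1 - (R'.2.1 + x'.2.1) - (R.2.2 + x.2.2 - (R'.2.2 + x'.2.2))),
      sq_nonneg (R.1 + x.1 - (R'.1 + x'.1) - (R.2.2 + x.2.2 - (R'.2.2 + x'.2.2))),
      abs_nonneg ((R.1 + x.1 - (R'.1 + x'.1)) + (R.2.1 + x.2.1 - (R'.2.1 + x'.2.1)) + (R.2.2 + x.2.2 - (R'.2.2 + x'.2.2)))]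

/-- ★ **SMALL LABEL.**  A stacking label `R + x` (`thsum R = 6ℓ`, `R₂ = R₁`, `3 ∣ R₂ − R₃`, `x` a layer vector) with `tsq ≤ 2` is `0`, at level `0`
(its coordinates are pairwise congruent mod `3` and bounded by `1`). [this file] -/
theorem small_label {R x : T3} {ℓ : ℤ} (hR : thsum R = 6 * ℓ) (hR1 : R.2.1 = R.1) (hR2 : (3 : ℤ) ∣ (R.2.1 - R.2.2)) (hx : InLayer x)
    (h : tsq (tadd R x) ≤ 2) : tadd R x = (0, 0, 0) ∧ ℓ = 0 := by
  obtain ⟨hs, ⟨a, ha⟩, ⟨b, hb⟩⟩ := hx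
  obtain ⟨c, hc⟩ := hR2
  simp only [thsum] at hR
  simp only [tsq, tadd] at h
  have h1 : -1 ≤ R.1 + x.1 ∧ R.1 + x.1 ≤ 1 := by
    constructor <;> nlinarith [sq_nonneg (R.2.1 + x.2.1), sq_nonneg (R.2.2 + x.2.2)]
  have h2 : -1 ≤ R.2.1 + x.2.1 ∧ R.2.1 + x.2.1 ≤ 1 := by
    constructor <;> nlinarith [sq_nonneg (R.1 + x.1), sq_nonneg (R.2.2 + x.2.2)]
  have h3 : -1 ≤ R.2.2 + x.2.2 ∧ R.2.2 + x.2.2 ≤ 1 := by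
    constructor <;> nlinarith [sq_nonneg (R.1 + x.1), sq_nonneg (R.2.1 + x.2.1)]
  have e1 : R.1 + x.1 = 0 := by omega
  have e2 : R.2.1 + x.2.1 = 0 := by omega
  have e3 : R.2.2 + x.2.2 = 0 := by omega
  exact ⟨Prod.ext e1 (Prod.ext e2 e3), by omega⟩

/-! ## §4  Reading steps -/

/-- FRAME POINT: the frame `B` (`‖B z‖ ≥ (399/400)ν‖z‖`) is onto; a point `p` with `‖p‖ ≤ (106/25)ν` is `B z` with `‖z‖ ≤ (106/25)(400/399)`. [this file] -/
theorem frame_point {B : EuclideanSpace ℝ (Fin 3) →ₗ[ℝ] EuclideanSpace ℝ (Fin 3)} {ν : ℝ} (hν : 0 < ν) (hB : ∀ z, 399 / 400 * ν * ‖z‖ ≤ ‖B z‖)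
    (p : EuclideanSpace ℝ (Fin 3)) (hp : ‖p‖ ≤ 106 / 25 * ν) : ∃ z, B z = p ∧ ‖z‖ ≤ 106 / 25 * (400 / 399) := by
  have hBinj : Function.Injective B := by
    intro a b hab
    have h := hB (a - b)
    rw [map_sub, hab, sub_self, norm_zero] at h
    have : ‖a - b‖ ≤ 0 := by nlinarith [norm_nonneg (a - b)]
    exact sub_eq_zero.mp (norm_le_zero_iff.mp this)
  obtain ⟨z, hz⟩ := (LinearMap.injective_iff_surjective.mp hBinj) p
  refine ⟨z, hz, ?_⟩
  have h := hB z
  rw [hz] at h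
  nlinarith

/-- LEVEL BOX: a label `(2ℓ,2ℓ,2ℓ) + u` (`thsum u = 0`) of model norm `≤ 24/5` has `|u_c| ≤ 18 − |ℓ|` (`placement` + `cover_B`). [this file] -/
theorem level_box {ℓ : ℤ} {u : T3} (hu0 : thsum u = 0) (hR : ‖mv (tadd (2 * ℓ, 2 * ℓ, 2 * ℓ) u)‖ ≤ 24 / 5) :
    |u.1| ≤ 18 - |ℓ| ∧ |u.2.1| ≤ 18 - |ℓ| ∧ |u.2.2| ≤ 18 - |ℓ| := by
  obtain ⟨hp1, hp2, hp3, hℓ⟩ := placement hu0 hR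
  have hcov := cover_B ℓ
  have hB18 : (0 : ℤ) ≤ 18 - |ℓ| := by linarith
  exact ⟨abs_le.mpr (abs_le_of_sq_le_sq' (by nlinarith) hB18), abs_le.mpr (abs_le_of_sq_le_sq' (by nlinarith) hB18),
    abs_le.mpr (abs_le_of_sq_le_sq' (by nlinarith) hB18)⟩

/-- ★ READ LEVEL: if `B z = p`, `c` is the lens point of `z` (`‖z − c‖ ≤ 9/10 − ρ₀`) at height `6ℓ + 6t` (`0 ≤ t ≤ 1`), and a label `r` of level `ℓ_r`
describes `p` up to `Δ` with `2((9/10 − ρ₀)β + Δ)² ≤ β²` (`height_budget`), then `ℓ_r ∈ {ℓ, ℓ+1}` (`slab_int`). [this file] -/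
theorem read_level {B : EuclideanSpace ℝ (Fin 3) →ₗ[ℝ] EuclideanSpace ℝ (Fin 3)} {ν Δ t : ℝ} {z c p : EuclideanSpace ℝ (Fin 3)} {ℓ ℓr : ℤ}
    {r : T3} (hν : 0 < ν) (hB : ∀ z, 399 / 400 * ν * ‖z‖ ≤ ‖B z‖) (hz : B z = p) (hzc : ‖z - c‖ ≤ 9 / 10 - rho0) (ht0 : 0 ≤ t) (ht1 : t ≤ 1)
    (hh : Real.sqrt 18 * (c 0 + c 1 + c 2) = 6 * ℓ + 6 * t) (hE : 2 * ((9 / 10 - rho0) * (399 / 400 * ν) + Δ) ^ 2 ≤ (399 / 400 * ν) ^ 2)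
    (hr : thsum r = 6 * ℓr) (hrΔ : ‖p - B (mv r)‖ ≤ Δ) : ℓr - ℓ = 0 ∨ ℓr - ℓ = 1 := by
  have h1 : 399 / 400 * ν * ‖z - mv r‖ ≤ Δ := by
    refine (hB _).trans ?_
    rw [map_sub, hz]
    exact hrΔ
  have h2 : ‖c - mv r‖ ≤ ‖z - c‖ + ‖z - mv r‖ := by
    have ee : c - mv r = (z - mv r) - (z - c) := by abel
    rw [ee]
    exact (norm_sub_le _ _).trans (le_of_eq (add_comm _ _))
  have hβ : (0 : ℝ) < 399 / 400 * ν := by positivity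
  have h3 : 399 / 400 * ν * ‖c - mv r‖ ≤ (9 / 10 - rho0) * (399 / 400 * ν) + Δ := by
    have := mul_le_mul_of_nonneg_left h2 hβ.le
    have := mul_le_mul_of_nonneg_left hzc hβ.le
    linarith
  have h4 : ‖c - mv r‖ ^ 2 ≤ 1 / 2 := by
    have h0 : 0 ≤ 399 / 400 * ν * ‖c - mv r‖ := by positivity
    have h5 : (399 / 400 * ν * ‖c - mv r‖) ^ 2 ≤ ((9 / 10 - rho0) * (399 / 400 * ν) + Δ) ^ 2 := pow_le_pow_left₀ h0 h3 2
    have h6 : (399 / 400 * ν) ^ 2 * (2 * ‖c - mv r‖ ^ 2) ≤ (399 / 400 * ν) ^ 2 * 1 := by nlinarith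
    have h7 := le_of_mul_le_mul_left h6 (by positivity)
    linarith
  rw [norm_sub_mv_sq] at h4
  have hd : (Real.sqrt 18 * c 0 - 2 * ℓ - ((r.1 : ℝ) - 2 * ℓ)) ^ 2 + (Real.sqrt 18 * c 1 - 2 * ℓ - ((r.2.1 : ℝ) - 2 * ℓ)) ^ 2 +
      (Real.sqrt 18 * c 2 - 2 * ℓ - ((r.2.2 : ℝ) - 2 * ℓ)) ^ 2 ≤ 9 := by
    have e1 : ∀ a b : ℝ, a - 2 * (ℓ : ℝ) - (b - 2 * ℓ) = a - b := fun a b => by ring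
    rw [e1, e1, e1]
    linarith
  have hr' : ((r.1 : ℝ) - 2 * ℓ) + ((r.2.1 : ℝ) - 2 * ℓ) + ((r.2.2 : ℝ) - 2 * ℓ) = 6 * ((ℓr - ℓ : ℤ) : ℝ) := by
    simp only [thsum] at hr
    have hc : ((r.1 + r.2.1 + r.2.2 : ℤ) : ℝ) = ((6 * ℓr : ℤ) : ℝ) := by rw [hr]
    push_cast at hc ⊢
    linarith
  have hP' : (Real.sqrt 18 * c 0 - 2 * ℓ) + (Real.sqrt 18 * c 1 - 2 * ℓ) + (Real.sqrt 18 * c 2 - 2 * ℓ) = 6 * t := by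
    linear_combination hh
  exact slab_int ht0 ht1 hP' hr' hd

/-- NOT SECOND SHELL: a site of the lens read through a second-shell pattern vector (`‖v‖ = √2`) of a level site `k` contradicts `first_shell_budget`. [this file] -/
theorem not_second_shell {y : Fin N → EuclideanSpace ℝ (Fin 3)} {k m : Fin N} {Ak : EuclideanSpace ℝ (Fin 3) →ₗ[ℝ] EuclideanSpace ℝ (Fin 3)}
    {Qk : EuclideanSpace ℝ (Fin 3) →ₗᵢ[ℝ] EuclideanSpace ℝ (Fin 3)} {v : EuclideanSpace ℝ (Fin 3)} {ν : ℝ} (hν : 0 < ν)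
    (hAv : ‖Ak v - Qk v‖ ≤ 1 / 1000) (hpos : dist (y m) (y k + nearestDist y k • Ak v) ≤ 1 / 10 ^ 4 * nearestDist y k)
    (hv2 : ‖v‖ = Real.sqrt 2) (hklo : 9026 / 10000 * ν ≤ nearestDist y k)
    (hmk : dist (y m) (y k) ≤ 401 / 400 * ν * (9 / 10 - rho0 + Real.sqrt 2 / 2) + dR ν 31) : False := by
  have hfar := shell_far hAv hpos
  rw [hv2] at hfar
  have hfs := first_shell_budget hν
  have h2 : (0 : ℝ) ≤ Real.sqrt 2 - 11 / 10000 := by linarith [sqrt_two_bounds.1]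
  have := mul_le_mul_of_nonneg_left hklo h2
  linarith

end Summit.AtomisticToContinuum.Crystallization.Theorems.OverbindingBudgetAffineCompressedCutReadingA
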